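import Literature.AnabelianGeometry.EtaleTheta.LogDivisorModelTateTowerThetaTwistTowerSignFree
import Literature.AnabelianGeometry.EtaleTheta.LogDivisorTowerRootLaw
import Literature.AnabelianGeometry.EtaleTheta.Discharge.Sec3Prop34iiOfGaloisCovering

/-!
# [EtTh] Def. 3.3 (iii) / ERRATUM E2 (a): the ROOT LAW HOLDS on the ε-free sign-free tower `towerC₃sf` of the `Ÿ`-skeleton over «GRP₃′»
# (file 3 part 2 of the 2c plan: quotient coverings of the compatible group and the equivariant root families)

S. Mochizuki, *The étale theta function …*, Publ. RIMS **45** (2009) [MochizukiEtTh2009], §3 Def. 3.3 (iii) pp.73–74, Prop. 3.2 (iii)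
p.70; ERRATUM E2 = [IUTchI] Rmk. 3.2.4 (i)(a) («for every `N ∈ ℕ_{≥1}`, `f` admits an `N`-th root over some tempered covering»)
[cite: MochizukiEtTh2009, Def 3.3 (iii) p.73].

CLASS (b) MODEL, sequel (abc-iut cell, layer L2; seat abc-iut-L2-t3 (gen 7)) of `…ThetaTwistTowerSignFree` (`towerC₃sf`, p488792) —
UNTOUCHED; the root element is the one of `…ThetaTwistTowerRoots` (p489028, `levelRoot`), written out here so that this file does not
wait for that module's build.  abc-iut-L2-d2's `LogDivisorModelTateTowerKummerTwistRootLaw.lean`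
(p480815) TRANSPOSED to the shear-semidirect compatible group `Compat 3 thetaShear` of abc-iut-L1-t6 (`toAdd_left_mul/_inv`,
`continuous_coordK/C`, `natElt`, `lvlC`, `closureC_lvlC_fixes`, p482446) and to the ε-free `Ÿ`-levels; abc-iut-L2-t3's
`rootLaw_ofTower_iff` (p456136) and abc-iut-w6-d048's `exists_bZero_quotient_of_invariant` BY NAME:
* §1 open subgroups of `Compat 3 thetaShear`: stabilisers `stabC₃`, Kummer levels `kumLevelC₃ m` (all three index-`< m` classes vanish;
  `natElt_mem_kumLevelC₃_iff`), and the stabiliser `fnStabC₃ m x` of a level-`m` function (open: `levelActFnMod_congr`);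
* §2 `quotCoverC₃ H` — `Compat/H` as a connected tempered covering (stabilisers are the conjugates); `le_lvlC_quotCoverC₃`; `countable_quot₃`;
* §3 **`rootLawC₃sf : (DivisorMonoids.ofTower towerC₃sf).RootLaw`** — E2 (a) HOLDS: for `b ∈ B₀(Y)` at level `n`, `K ≥ 1`, `m := n + K`,
  the value `b(y₀)` (ε-free) has the level-`m` root `(ζ^{qζ̃}, ϖ̈^{qc} Ü^{qk} Θ̈^{qt})` (= p489028's `levelRoot`), and over `Y′ := Compat/(Stab(y₀) ∩ kumLevelC₃ m ∩ fnStabC₃ m r₀)`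
  (level `l′ ≥ m`) the family `[g] ↦ g ·_{l′} res r₀` is an equivariant `K`-th root of `b` pulled back and moved to level `l′` — by the
  EQUIVARIANCE of the transitions on `Compat` (`resFnC₃_levelActFnMod`, p487602).
DEVIATION OF RECORD (design (β), R922): the torsion sign of Prop. 1.4 (ii) is not carried (sign-free levels).  HONEST FRAMING: a
combinatorial consistency witness for OUR typed v2 interface; nothing here bears on [IUTchIII] Cor. 3.12; no side taken; typed ≠ proved.
-/

noncomputable section

namespace Literature.AnabelianGeometry.EtaleTheta

open CategoryTheory Opposite Function Literature.AlgebraicGeometry.Frobenioids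
  Literature.AlgebraicGeometry.Frobenioids.QuasiTemperoid Literature.AnabelianGeometry.SemiGraphs LogDivisorTower

namespace LogDivisorModel

namespace TateTowerThetaTwist

open TateTowerTheta
open TateTowerKummerTwist (M Cst N coe_N N_dvd_M N_dvd_N eN N_mul_eN eN_self eN_mul_eN eN_pos upAdd upAdd_trans
  natCast_factorial_eq_zero_iff)
open TateTowerKummerTwistR (Kum)
open TateTowerKummerTwistRShear (Grp act red thetaShear compat Compat closureC mem_closureC_iff levelsC lvlC natElt
  coord_eq_zero_of_mem_closureC right_eq_one_of_mem_closureC)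

/-- The roots of unity of level `n` (abc-iut-L2-d2's `MuN`, spelled out to avoid the `RootsOfUnityGalois.MuN` homonym).
[cite: MochizukiEtTh2009, §1 p.13] -/
abbrev Mu₃ (n : ℕ) : Type := Multiplicative (ZMod (N n))

/-! ## §1 Open subgroups of the compatible group -/

/-- The stabiliser of a point of a tempered `Compat`-set. [cite: MochizukiSemiAnbd2006, §3 p.33] -/
def stabC₃ (T : BTemp (Compat 3 thetaShear)) (y : T.obj.V) : Subgroup (Compat 3 thetaShear) where
  carrier := {g | T.obj.ρ g y = y}
  mul_mem' {a b} ha hb := by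
    change T.obj.ρ (a * b) y = y
    rw [BTempConnected.ρ_mul_apply, hb, ha]
  one_mem' := BTempConnected.ρ_one_apply T y
  inv_mem' {a} ha := by
    change T.obj.ρ a⁻¹ y = y
    conv_lhs => rw [← ha]
    exact BTempConnected.ρ_inv_apply T a y

/-- Stabilisers are open. [cite: MochizukiSemiAnbd2006, §3 p.33] -/
theorem isOpen_stabC₃ (T : BTemp (Compat 3 thetaShear)) (y : T.obj.V) : IsOpen (stabC₃ T y : Set (Compat 3 thetaShear)) :=
  T.property.2 y

/-- `kumLevelC₃ m`: ALL THREE Kummer classes of every index `< m` vanish. [cite: MochizukiEtTh2009, Def 3.3 (ii) p.73] -/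
def kumLevelC₃ (m : ℕ) : Subgroup (Compat 3 thetaShear) where
  carrier := {g | ∀ i < m, Multiplicative.toAdd (g : Grp 3 thetaShear).left i = 0}
  mul_mem' {a b} ha hb i hi := by
    rw [Subgroup.coe_mul, TateTowerKummerTwistRShear.toAdd_left_mul, ha i hi, hb i hi, Matrix.mulVec_zero, smul_zero, add_zero]
  one_mem' i _ := by rw [Subgroup.coe_one, SemidirectProduct.one_left, toAdd_one, Pi.zero_apply]
  inv_mem' {a} ha i hi := by
    rw [Subgroup.coe_inv, TateTowerKummerTwistRShear.toAdd_left_inv, ha i hi, neg_zero, Matrix.mulVec_zero, smul_zero]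

/-- `Δ_m ∩ Compat ⊆ kumLevelC₃ m`. [cite: MochizukiEtTh2009, Def 3.3 (ii) p.73] -/
theorem closureC_le_kumLevelC₃ (m : ℕ) : closureC 3 thetaShear m ≤ kumLevelC₃ m := fun _ hg i hi =>
  coord_eq_zero_of_mem_closureC 3 thetaShear hg i hi

/-- `kumLevelC₃ m` is open (finitely many discrete coordinates are constrained). [cite: MochizukiEtTh2009, Def 3.3 (ii) p.73] -/
theorem isOpen_kumLevelC₃ (m : ℕ) : IsOpen (kumLevelC₃ m : Set (Compat 3 thetaShear)) := by
  have h : (kumLevelC₃ m : Set (Compat 3 thetaShear)) =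
      ⋂ i ∈ Finset.range m, (fun g : Compat 3 thetaShear => Multiplicative.toAdd (g : Grp 3 thetaShear).left i) ⁻¹' {0} := by
    ext g
    simp only [Set.mem_iInter, Set.mem_preimage, Set.mem_singleton_iff, Finset.mem_range]
    rfl
  rw [h]
  exact isOpen_biInter_finset fun i _ =>
    (isOpen_discrete _).preimage ((TateTowerKummerTwistRShear.continuous_coordK 3 thetaShear i).comp continuous_subtype_val)

/-- abc-iut-L1-t6's integer `(j+1)!` lies in `kumLevelC₃ m` iff `m ≤ j`. [cite: MochizukiEtTh2009, Def 3.3 (ii) p.73] -/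
theorem natElt_mem_kumLevelC₃_iff (j m : ℕ) : natElt 3 thetaShear j ∈ kumLevelC₃ m ↔ m ≤ j := by
  have hc : ∀ i, Multiplicative.toAdd ((natElt 3 thetaShear j : Grp 3 thetaShear)).left i =
      fun _ => ((((j + 1).factorial : ℕ)) : ZMod (M i)) := fun i => by
    change Multiplicative.toAdd (TateTowerKummerTwistRShear.ofKum 3 thetaShear _).left i = _
    rw [TateTowerKummerTwistRShear.ofKum, SemidirectProduct.left_inl, toAdd_ofAdd]
  constructor
  · intro h
    by_contra hm
    have h1 := congrFun (h j (lt_of_not_ge hm)) 0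
    rw [hc, Pi.zero_apply, natCast_factorial_eq_zero_iff] at h1
    exact lt_irrefl j h1
  · intro h i hi
    rw [hc]
    exact funext fun _ => (natCast_factorial_eq_zero_iff i j).2 (lt_of_lt_of_le hi h)

/-- The stabiliser of a function `x` of level `m` under the level-`m` action of «GRP₃′» (read modulo `N m`).
[cite: MochizukiEtTh2009, Def 3.3 (iii) p.73] -/
def fnStabC₃ (m : ℕ) (x : Fn (Mu₃ m)) : Subgroup (Compat 3 thetaShear) where
  carrier := {g | levelActFnMod m (N m) (N_dvd_M m) (g : Grp 3 thetaShear) x = x}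
  mul_mem' {a b} ha hb := by
    change levelActFnMod m (N m) (N_dvd_M m) ((a * b : Compat 3 thetaShear) : Grp 3 thetaShear) x = x
    rw [Subgroup.coe_mul, map_mul, MulAut.mul_apply, hb, ha]
  one_mem' := by
    change levelActFnMod m (N m) (N_dvd_M m) ((1 : Compat 3 thetaShear) : Grp 3 thetaShear) x = x
    rw [Subgroup.coe_one, map_one, MulAut.one_apply]
  inv_mem' {a} ha := by
    change levelActFnMod m (N m) (N_dvd_M m) ((a⁻¹ : Compat 3 thetaShear) : Grp 3 thetaShear) x = x
    rw [Subgroup.coe_inv, map_inv, MulAut.inv_apply]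
    exact (MulEquiv.symm_apply_eq _).2 ha.symm

/-- `fnStabC₃ m x` is open: with `g₀` it contains every `g` with the same index-`m` data (`levelActFnMod_congr`).
[cite: MochizukiEtTh2009, Def 3.3 (iii) p.73] -/
theorem isOpen_fnStabC₃ (m : ℕ) (x : Fn (Mu₃ m)) : IsOpen (fnStabC₃ m x : Set (Compat 3 thetaShear)) := by
  let F : Compat 3 thetaShear → (Fin 3 → ZMod (M m)) × ZMod (M m) × Multiplicative ℤ :=
    fun g => (Multiplicative.toAdd (g : Grp 3 thetaShear).left m, ((g : Grp 3 thetaShear).right.1 m : ZMod (M m)),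
      (g : Grp 3 thetaShear).right.2)
  have hright : Continuous fun g : Grp 3 thetaShear => g.right.2 :=
    continuous_snd.comp (continuous_snd.comp (TateTowerKummerTwistRShear.isInducing_leftRight 3 thetaShear).continuous)
  have hF : Continuous F :=
    ((TateTowerKummerTwistRShear.continuous_coordK 3 thetaShear m).comp continuous_subtype_val).prodMk
      ((Units.continuous_val.comp ((TateTowerKummerTwistRShear.continuous_coordC 3 thetaShear m).comp continuous_subtype_val)).prodMk
        (hright.comp continuous_subtype_val))
  refine isOpen_iff_forall_mem_open.2 fun g₀ hg₀ => ⟨F ⁻¹' {F g₀}, fun g hg => ?_, (isOpen_discrete _).preimage hF, rfl⟩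
  obtain ⟨hk, hc2⟩ := Prod.ext_iff.1 (Set.mem_singleton_iff.1 hg)
  obtain ⟨hc, h2⟩ := Prod.ext_iff.1 hc2
  change levelActFnMod m (N m) (N_dvd_M m) (g : Grp 3 thetaShear) x = x
  -- the level action depends only on the index-`m` data `(k_m, c_m, a)`
  have hcu : (g : Grp 3 thetaShear).right.1 m = (g₀ : Grp 3 thetaShear).right.1 m := Units.ext hc
  have hk' : Multiplicative.toAdd (g : Grp 3 thetaShear).left m = Multiplicative.toAdd (g₀ : Grp 3 thetaShear).left m := hk
  have h2' : (g : Grp 3 thetaShear).right.2 = (g₀ : Grp 3 thetaShear).right.2 := h2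
  have hcg : levelActFnMod m (N m) (N_dvd_M m) (g : Grp 3 thetaShear) = levelActFnMod m (N m) (N_dvd_M m) (g₀ : Grp 3 thetaShear) := by
    rw [levelActFnMod_apply, levelActFnMod_apply, h2']
    have h1 : kumActMod m (N m) (N_dvd_M m) (g : Grp 3 thetaShear).left = kumActMod m (N m) (N_dvd_M m) (g₀ : Grp 3 thetaShear).left :=
      MulEquiv.ext fun y => by rw [kumActMod_apply, kumActMod_apply, hk']
    have h3 : levelCharMod m (N m) (N_dvd_M m) (g : Grp 3 thetaShear).right.1 =
        levelCharMod m (N m) (N_dvd_M m) (g₀ : Grp 3 thetaShear).right.1 :=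
      MulEquiv.ext fun z => by rw [levelCharMod_apply, levelCharMod_apply, hcu]
    rw [h1, h3]
  rw [hcg]
  exact hg₀

/-! ## §2 Quotient coverings of the compatible group and their levels -/

/-- Stabilisers in `Compat/H`: `k` fixes `gH` iff `g⁻¹ k g ∈ H`. [cite: MochizukiFrdII2008, Ex 1.3 (ii) p.11] -/
theorem ofMulAction_quot_fix_iff₃ (H : Subgroup (Compat 3 thetaShear)) (g k : Compat 3 thetaShear) :
    (Action.ofMulAction (Compat 3 thetaShear) (Compat 3 thetaShear ⧸ H)).ρ k (g : Compat 3 thetaShear ⧸ H) =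
      (g : Compat 3 thetaShear ⧸ H) ↔ g⁻¹ * k * g ∈ H := by
  rw [Action.ofMulAction_apply, MulAction.Quotient.smul_coe, smul_eq_mul]
  change ((k * g : Compat 3 thetaShear) : Compat 3 thetaShear ⧸ H) = (g : Compat 3 thetaShear ⧸ H) ↔ _
  rw [QuotientGroup.eq, ← inv_mem_iff, mul_inv_rev, inv_inv, ← mul_assoc]

/-- **The connected tempered covering `Compat/H`** for an open subgroup `H` of countable index. [cite: MochizukiFrdII2008, Ex 1.3 (ii) p.11] -/
def quotCoverC₃ (H : Subgroup (Compat 3 thetaShear)) (hH : IsOpen (H : Set (Compat 3 thetaShear)))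
    (hc : Countable (Compat 3 thetaShear ⧸ H)) : ConnectedPart (BTemp (Compat 3 thetaShear)) :=
  ⟨⟨Action.ofMulAction (Compat 3 thetaShear) (Compat 3 thetaShear ⧸ H), hc, fun q => by
      induction q using QuotientGroup.induction_on with
      | H g =>
        have h : {k : Compat 3 thetaShear | (Action.ofMulAction (Compat 3 thetaShear) (Compat 3 thetaShear ⧸ H)).ρ k
            (g : Compat 3 thetaShear ⧸ H) = (g : Compat 3 thetaShear ⧸ H)} =
            (fun k : Compat 3 thetaShear => g⁻¹ * k * g) ⁻¹' (H : Set (Compat 3 thetaShear)) :=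
          Set.ext fun k => ofMulAction_quot_fix_iff₃ H g k
        rw [h]
        exact hH.preimage ((continuous_const.mul continuous_id).mul continuous_const)⟩,
    BTempConnected.isConnectedObj_of_transitive _ ((1 : Compat 3 thetaShear) : Compat 3 thetaShear ⧸ H) fun q => by
      induction q using QuotientGroup.induction_on with
      | H g => exact ⟨g, by rw [Action.ofMulAction_apply, MulAction.Quotient.smul_coe, smul_eq_mul, mul_one]⟩⟩

/-- If `Δ_l ∩ Compat` fixes `Compat/H` then `Δ_l ∩ Compat ⊆ H`. [cite: MochizukiEtTh2009, Def 3.3 (i) p.72] -/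
theorem closureC_le_of_fixes₃ (H : Subgroup (Compat 3 thetaShear)) (hH : IsOpen (H : Set (Compat 3 thetaShear)))
    (hc : Countable (Compat 3 thetaShear ⧸ H)) (l : ℕ)
    (h : ∀ g ∈ closureC 3 thetaShear l, ∀ y : (quotCoverC₃ H hH hc).obj.obj.V, (quotCoverC₃ H hH hc).obj.obj.ρ g y = y) :
    closureC 3 thetaShear l ≤ H := fun g hg => by
  have h1 := (ofMulAction_quot_fix_iff₃ H 1 g).1 (h g hg ((1 : Compat 3 thetaShear) : Compat 3 thetaShear ⧸ H))
  rwa [inv_one, one_mul, mul_one] at h1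

/-- **Level lower bound**: if `H ⊆ kumLevelC₃ m` then `m ≤ lvlC (Compat/H)`. [cite: MochizukiEtTh2009, Def 3.3 (ii) p.73] -/
theorem le_lvlC_quotCoverC₃ (H : Subgroup (Compat 3 thetaShear)) (hH : IsOpen (H : Set (Compat 3 thetaShear)))
    (hc : Countable (Compat 3 thetaShear ⧸ H)) {m : ℕ} (hm : H ≤ kumLevelC₃ m) : m ≤ lvlC 3 thetaShear (quotCoverC₃ H hH hc) := by
  have h := closureC_le_of_fixes₃ H hH hc _ (TateTowerKummerTwistRShear.closureC_lvlC_fixes 3 thetaShear (quotCoverC₃ H hH hc))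
  exact (natElt_mem_kumLevelC₃_iff _ m).1 (hm (h ((TateTowerKummerTwistRShear.natElt_mem_closureC_iff 3 thetaShear _ _).2 le_rfl)))

/-- **Countability of `Compat/(Stab(y₀) ∩ kumLevelC₃ m ∩ fnStabC₃ m r₀)`**: the coset of `g` is determined by `g·y₀`, the classes of `g`
of index `< m`, and `g · r₀`. [cite: MochizukiSemiAnbd2006, §3 p.33] -/
theorem countable_quot₃ (Y : ConnectedPart (BTemp (Compat 3 thetaShear))) (y₀ : Y.obj.obj.V) (m : ℕ) (r₀ : Fn (Mu₃ m)) :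
    Countable (Compat 3 thetaShear ⧸ (stabC₃ Y.obj y₀ ⊓ kumLevelC₃ m ⊓ fnStabC₃ m r₀)) := by
  haveI : Countable Y.obj.obj.V := Y.obj.property.1
  haveI : ∀ i : Fin m, NeZero (M (i : ℕ)) := fun i => ⟨(Nat.factorial_pos _).ne'⟩
  haveI : Countable (Fn (Mu₃ m)) :=
    Countable.of_equiv (ZMod (N m) × (ZMod 2 × ℤ × ℤ × ℤ)) (Multiplicative.ofAdd.prodCongr Multiplicative.ofAdd)
  let H := stabC₃ Y.obj y₀ ⊓ kumLevelC₃ m ⊓ fnStabC₃ m r₀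
  let F : Compat 3 thetaShear → Y.obj.obj.V × (∀ i : Fin m, Fin 3 → ZMod (M i)) × Fn (Mu₃ m) :=
    fun g => (Y.obj.obj.ρ g y₀, fun i => Multiplicative.toAdd (g : Grp 3 thetaShear).left i,
      levelActFnMod m (N m) (N_dvd_M m) (g : Grp 3 thetaShear) r₀)
  have hF : ∀ a b : Compat 3 thetaShear, a⁻¹ * b ∈ H → F a = F b := by
    intro a b hab
    obtain ⟨⟨h1, h2⟩, h3⟩ := hab
    have hb : b = a * (a⁻¹ * b) := by rw [mul_inv_cancel_left]
    refine Prod.ext ?_ (Prod.ext (funext fun i => ?_) ?_)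
    · change Y.obj.obj.ρ a y₀ = Y.obj.obj.ρ b y₀
      rw [hb, BTempConnected.ρ_mul_apply]
      exact (congrArg _ h1).symm
    · change Multiplicative.toAdd (a : Grp 3 thetaShear).left i = Multiplicative.toAdd (b : Grp 3 thetaShear).left i
      rw [hb, Subgroup.coe_mul, TateTowerKummerTwistRShear.toAdd_left_mul, h2 i i.2, Matrix.mulVec_zero, smul_zero, add_zero]
    · change levelActFnMod m (N m) (N_dvd_M m) (a : Grp 3 thetaShear) r₀ = levelActFnMod m (N m) (N_dvd_M m) (b : Grp 3 thetaShear) r₀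
      have h3' : levelActFnMod m (N m) (N_dvd_M m) ((a⁻¹ * b : Compat 3 thetaShear) : Grp 3 thetaShear) r₀ = r₀ := h3
      rw [hb, Subgroup.coe_mul, map_mul, MulAut.mul_apply, h3']
  refine Function.Injective.countable (f := fun q : Compat 3 thetaShear ⧸ H => Quotient.liftOn' q F fun a b hab =>
    hF a b (QuotientGroup.leftRel_apply.1 hab)) fun q₁ q₂ hq => ?_
  induction q₁ using QuotientGroup.induction_on with
  | H a =>
    induction q₂ using QuotientGroup.induction_on with
    | H b =>
      change F a = F b at hq
      obtain ⟨h1, h23⟩ := Prod.ext_iff.1 hq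
      obtain ⟨h2, h3⟩ := Prod.ext_iff.1 h23
      refine QuotientGroup.eq.2 ⟨⟨?_, fun i hi => ?_⟩, ?_⟩
      · change Y.obj.obj.ρ (a⁻¹ * b) y₀ = y₀
        rw [BTempConnected.ρ_mul_apply]
        exact (congrArg _ h1.symm).trans (BTempConnected.ρ_inv_apply Y.obj a y₀)
      · have h2i := congrFun h2 ⟨i, hi⟩
        change Multiplicative.toAdd (a : Grp 3 thetaShear).left i = Multiplicative.toAdd (b : Grp 3 thetaShear).left i at h2i
        rw [Subgroup.coe_mul, Subgroup.coe_inv, TateTowerKummerTwistRShear.toAdd_left_mul, TateTowerKummerTwistRShear.toAdd_left_inv,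
          SemidirectProduct.inv_right, Prod.fst_inv, Prod.snd_inv, Pi.inv_apply, ← h2i, ← smul_add, ← Matrix.mulVec_add,
          neg_add_cancel, Matrix.mulVec_zero, smul_zero]
      · change levelActFnMod m (N m) (N_dvd_M m) ((a⁻¹ * b : Compat 3 thetaShear) : Grp 3 thetaShear) r₀ = r₀
        have h3' : levelActFnMod m (N m) (N_dvd_M m) (a : Grp 3 thetaShear) r₀ =
            levelActFnMod m (N m) (N_dvd_M m) (b : Grp 3 thetaShear) r₀ := h3
        rw [Subgroup.coe_mul, Subgroup.coe_inv, map_mul, MulAut.mul_apply, ← h3', map_inv, MulAut.inv_apply_self]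

/-! ## §3 E2 (a): the root law on the ε-free tower -/

/-- Raw transitions compose (ℕ-indexed form of `towerC₃.resFn_trans`). [cite: MochizukiEtTh2009, Def 3.3 (iii) p.73] -/
theorem resFn_upAdd_trans {i j k : ℕ} (hij : i ≤ j) (hjk : j ≤ k) (f : Fn (Mu₃ i)) :
    resFn (upAdd hjk) (eN j k) (resFn (upAdd hij) (eN i j) f) = resFn (upAdd (hij.trans hjk)) (eN i k) f := by
  refine Prod.ext (Multiplicative.toAdd.injective ?_) (Multiplicative.toAdd.injective ?_)
  · show upAdd hjk (upAdd hij (Multiplicative.toAdd f.1)) = upAdd (hij.trans hjk) (Multiplicative.toAdd f.1)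
    exact upAdd_trans hij hjk _
  · show resExp (eN j k) (resExp (eN i j) (Multiplicative.toAdd f.2)) = resExp (eN i k) (Multiplicative.toAdd f.2)
    rw [← resExp_mul, eN_mul_eN hij hjk]

/-- **E2 (a) — the ROOT LAW — HOLDS on the ε-free sign-free tower `towerC₃sf`**: every `b ∈ B₀(Y)` (level `n = lvlC Y`) acquires, for
every `K ≥ 1`, a `K`-th root over the connected tempered covering `Y′ = Compat/(Stab(y₀) ∩ kumLevelC₃ (n+K) ∩ fnStabC₃ (n+K) r₀)` at
the level `l′ ≥ n + K` of `Y′` — the family `[g] ↦ g ·_{l′} res r₀`, well defined, equivariant, a `K`-th root of `b` pulled back to `Y′`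
and moved to level `l′` because the transitions are EQUIVARIANT on `Compat`. [cite: MochizukiEtTh2009, Def 3.3 (iii) p.73] -/
theorem rootLawC₃sf : (DivisorMonoids.ofTower towerC₃sf).RootLaw := by
  rw [LogDivisorTower.rootLaw_ofTower_iff]
  intro K Y b
  obtain ⟨y₀⟩ := BTempConnected.nonempty_of_isConnectedObj Y.obj Y.property
  -- the level `n` of `Y`, the target level `m = n + K`, `eN n m = K q`
  obtain ⟨q, hq⟩ : (K : ℕ) ∣ eN (lvlC 3 thetaShear Y) (lvlC 3 thetaShear Y + (K : ℕ)) := by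
    have h1 : (lvlC 3 thetaShear Y + 1).factorial * (K : ℕ).factorial ∣ (lvlC 3 thetaShear Y + 1 + (K : ℕ)).factorial :=
      Nat.factorial_mul_factorial_dvd_factorial_add _ _
    have h2 : (lvlC 3 thetaShear Y + 1).factorial * eN (lvlC 3 thetaShear Y) (lvlC 3 thetaShear Y + (K : ℕ)) =
        (lvlC 3 thetaShear Y + 1 + (K : ℕ)).factorial := by
      have h3 := N_mul_eN (Nat.le_add_right (lvlC 3 thetaShear Y) (K : ℕ))
      rw [coe_N, coe_N, Nat.add_right_comm] at h3
      exact h3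
    rw [← h2] at h1
    exact (Nat.dvd_factorial K.pos le_rfl).trans ((Nat.mul_dvd_mul_iff_left (Nat.factorial_pos _)).mp h1)
  have hnm : lvlC 3 thetaShear Y ≤ lvlC 3 thetaShear Y + (K : ℕ) := Nat.le_add_right _ _
  -- the value at `y₀` (ε-free) and its level-`m` `K`-th root
  let x₀ : (towerC₃sf.Z (lvlC 3 thetaShear Y)).Fn := b.1 y₀
  let r₀ : Fn (Mu₃ (lvlC 3 thetaShear Y + (K : ℕ))) :=
    (Multiplicative.ofAdd (((q * (Multiplicative.toAdd x₀.1.1).val : ℕ)) : ZMod (N (lvlC 3 thetaShear Y + (K : ℕ)))),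
      Multiplicative.ofAdd (((0 : ZMod 2), (q : ℤ) * eC (Multiplicative.toAdd x₀.1.2), (q : ℤ) * eU (Multiplicative.toAdd x₀.1.2),
        (q : ℤ) * eT (Multiplicative.toAdd x₀.1.2)) : Exp))
  have hr₀mem : r₀ ∈ epsKer (ZMod (N (lvlC 3 thetaShear Y + (K : ℕ)))) := rfl
  -- `r₀ ^ K` is the transition of the (ε-free!) value `x₀` (abc-iut-L2-d2's `root_pow_eq_resFnC`; p489028 `levelRoot_pow`)
  have hr₀ : r₀ ^ (K : ℕ) = resFn (upAdd hnm) (eN (lvlC 3 thetaShear Y) (lvlC 3 thetaShear Y + (K : ℕ))) x₀.1 := by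
    refine Prod.ext (Multiplicative.toAdd.injective ?_) (Multiplicative.toAdd.injective ?_)
    · change (K : ℕ) • (((q * (Multiplicative.toAdd x₀.1.1).val : ℕ)) : ZMod (N (lvlC 3 thetaShear Y + (K : ℕ)))) =
        upAdd hnm (Multiplicative.toAdd x₀.1.1)
      conv_rhs => rw [← ZMod.natCast_zmod_val (Multiplicative.toAdd x₀.1.1), ← Int.cast_natCast, TateTowerKummerTwist.upAdd_intCast,
        Int.cast_natCast, ← Nat.cast_mul]
      rw [nsmul_eq_mul, ← Nat.cast_mul, ← mul_assoc, ← hq, Nat.mul_comm]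
    · change (K : ℕ) • (((0 : ZMod 2), (q : ℤ) * eC (Multiplicative.toAdd x₀.1.2), (q : ℤ) * eU (Multiplicative.toAdd x₀.1.2),
          (q : ℤ) * eT (Multiplicative.toAdd x₀.1.2)) : Exp) =
        resExp (eN (lvlC 3 thetaShear Y) (lvlC 3 thetaShear Y + (K : ℕ))) (Multiplicative.toAdd x₀.1.2)
      have hx' : (Multiplicative.toAdd x₀.1.2).1 = 0 := x₀.2
      refine ext_exp ?_ ?_ ?_ ?_
      · rw [Prod.smul_fst, smul_zero]
        exact hx'.symm
      · rw [eC_resExp, hq, Nat.cast_mul]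
        change (K : ℕ) • ((q : ℤ) * eC (Multiplicative.toAdd x₀.1.2)) = _
        rw [nsmul_eq_mul]; ring
      · rw [eU_resExp, hq, Nat.cast_mul]
        change (K : ℕ) • ((q : ℤ) * eU (Multiplicative.toAdd x₀.1.2)) = _
        rw [nsmul_eq_mul]; ring
      · rw [eT_resExp, hq, Nat.cast_mul]
        change (K : ℕ) • ((q : ℤ) * eT (Multiplicative.toAdd x₀.1.2)) = _
        rw [nsmul_eq_mul]; ring
  -- the cover `Y′`
  let H : Subgroup (Compat 3 thetaShear) :=
    stabC₃ Y.obj y₀ ⊓ kumLevelC₃ (lvlC 3 thetaShear Y + (K : ℕ)) ⊓ fnStabC₃ (lvlC 3 thetaShear Y + (K : ℕ)) r₀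
  have hH : IsOpen (H : Set (Compat 3 thetaShear)) :=
    ((isOpen_stabC₃ Y.obj y₀).inter (isOpen_kumLevelC₃ _)).inter (isOpen_fnStabC₃ _ r₀)
  let Y' : ConnectedPart (BTemp (Compat 3 thetaShear)) := quotCoverC₃ H hH (countable_quot₃ Y y₀ _ r₀)
  -- the covering map `Y′ → Y`, `[g] ↦ g · y₀`
  obtain ⟨f₀, hf₀⟩ := BTempConnected.exists_hom_of_stabilizer_le (T₁ := Y'.obj) (T₂ := Y.obj)
    ((1 : Compat 3 thetaShear) : Compat 3 thetaShear ⧸ H)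
    (fun q => by
      induction q using QuotientGroup.induction_on with
      | H g => exact ⟨g, by
          change (Action.ofMulAction (Compat 3 thetaShear) (Compat 3 thetaShear ⧸ H)).ρ g _ = _
          rw [Action.ofMulAction_apply, MulAction.Quotient.smul_coe, smul_eq_mul, mul_one]⟩)
    y₀ (fun g hg => by
      have h1 := (ofMulAction_quot_fix_iff₃ H 1 g).1 hg
      rw [inv_one, one_mul, mul_one] at h1
      exact h1.1.1)
  let f : Y' ⟶ Y := ObjectProperty.homMk f₀
  -- the level of `Y′` is at least `m`
  have hml : lvlC 3 thetaShear Y + (K : ℕ) ≤ lvlC 3 thetaShear Y' := le_lvlC_quotCoverC₃ H hH _ (fun g hg => hg.1.2)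
  have hnl : lvlC 3 thetaShear Y ≤ lvlC 3 thetaShear Y' := hnm.trans hml
  -- the root at level `l′`, ε-free, as an equivariant family on `Compat/H`
  have hmem : resFn (upAdd hml) (eN (lvlC 3 thetaShear Y + (K : ℕ)) (lvlC 3 thetaShear Y')) r₀ ∈ epsKer (ZMod (N (lvlC 3 thetaShear Y'))) :=
    resFn_mem_epsKer _ _ hr₀mem
  obtain ⟨r, hr⟩ := (towerC₃sf.act (lvlC 3 thetaShear Y')).exists_bZero_quotient_of_invariant H
    (f := (⟨resFn (upAdd hml) (eN (lvlC 3 thetaShear Y + (K : ℕ)) (lvlC 3 thetaShear Y')) r₀, hmem⟩ : (towerC₃sf.Z (lvlC 3 thetaShear Y')).Fn)) trivial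
    (fun h hh => Subtype.ext (by
      change levelActFnMod (lvlC 3 thetaShear Y') (N (lvlC 3 thetaShear Y')) (N_dvd_M (lvlC 3 thetaShear Y')) (h : Grp 3 thetaShear) (resFn (upAdd hml) (eN (lvlC 3 thetaShear Y + (K : ℕ)) (lvlC 3 thetaShear Y')) r₀) =
        resFn (upAdd hml) (eN (lvlC 3 thetaShear Y + (K : ℕ)) (lvlC 3 thetaShear Y')) r₀
      rw [← resFnC₃_eq, ← resFnC₃_levelActFnMod hml h r₀]
      exact congrArg (resFnC₃ hml) hh.2))
  refine ⟨Y', f, r, Subtype.ext (funext fun s => ?_)⟩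
  induction s using QuotientGroup.induction_on with
  | H g =>
    have e1 : (g : Compat 3 thetaShear ⧸ H) =
        (Action.ofMulAction (Compat 3 thetaShear) (Compat 3 thetaShear ⧸ H)).ρ g ((1 : Compat 3 thetaShear) : Compat 3 thetaShear ⧸ H) := by
      rw [Action.ofMulAction_apply, MulAction.Quotient.smul_coe, smul_eq_mul, mul_one]
    have hfg : f.hom.hom.hom (g : Compat 3 thetaShear ⧸ H) = Y.obj.obj.ρ g y₀ := by
      have h := BTempConnected.hom_ρ f₀ g ((1 : Compat 3 thetaShear) : Compat 3 thetaShear ⧸ H)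
      rw [hf₀] at h
      exact (congrArg _ e1).trans h
    have hrg : r.1 (g : Compat 3 thetaShear ⧸ H) =
        (towerC₃sf.act (lvlC 3 thetaShear Y')).actFn g ⟨resFn (upAdd hml) (eN (lvlC 3 thetaShear Y + (K : ℕ)) (lvlC 3 thetaShear Y')) r₀, hmem⟩ := by
      have h := r.2.2 g ((1 : Compat 3 thetaShear) : Compat 3 thetaShear ⧸ H)
      rw [hr] at h
      exact (congrArg r.1 e1).trans h
    have hbg : b.1 (Y.obj.obj.ρ g y₀) = (towerC₃sf.act (lvlC 3 thetaShear Y)).actFn g x₀ := b.2.2 g y₀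
    change r.1 (g : Compat 3 thetaShear ⧸ H) ^ (K : ℕ) = towerC₃sf.resFn _ (b.1 (f.hom.hom.hom (g : Compat 3 thetaShear ⧸ H)))
    rw [hrg, hfg, hbg]
    refine Subtype.ext ?_
    change levelActFnMod (lvlC 3 thetaShear Y') (N (lvlC 3 thetaShear Y')) (N_dvd_M (lvlC 3 thetaShear Y')) (g : Grp 3 thetaShear) (resFn (upAdd hml) (eN (lvlC 3 thetaShear Y + (K : ℕ)) (lvlC 3 thetaShear Y')) r₀) ^ (K : ℕ) =
      resFn (upAdd hnl) (eN (lvlC 3 thetaShear Y) (lvlC 3 thetaShear Y')) (levelActFnMod (lvlC 3 thetaShear Y) (N (lvlC 3 thetaShear Y)) (N_dvd_M (lvlC 3 thetaShear Y)) (g : Grp 3 thetaShear) x₀.1)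
    rw [← map_pow, ← map_pow, hr₀, resFn_upAdd_trans hnm hml, ← resFnC₃_eq]
    exact (resFnC₃_levelActFnMod hnl g x₀.1).symm

end TateTowerThetaTwist

end LogDivisorModel

end Literature.AnabelianGeometry.EtaleTheta

end
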